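/-
Copyright: lit-balaban cell, Phase-2 proof seat p33 (gen 6).  Statement-level skeleton of a published paper; no proof claims beyond
what the kernel checks below.
-/
import Literature.MathematicalPhysics.QuantumFieldTheory.BalabanImbrieJaffe1984to88.BIJ85Ineq732BackgroundStab

/-!
# `BalabanImbrieJaffe1984to88.BIJ85Ineq732BackgroundFirst` — T. Bałaban, J. Imbrie, A. Jaffe, *Renormalization of the Higgs model:
minimizers, propagators and the stability of mean field theory*, Commun. Math. Phys. **97** (1985) 299–329
[BalabanImbrieJaffe1985]: the FIRST printed form of the scalar stability estimate **(7.3.2)** p. 326 — `u_k(b)` (the transport of the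
background along the unit bond `b`, (5.1.2)) in the covariant derivative of `ψ` — AT THE (4.5.4)-SHAPED BACKGROUND `u = Q^{s*}_kv·e^{iθ}`, from the
second form (this seat's `BIJ85Ineq732BackgroundStab`, p265577): there `u_k(b) = v_b·e^{iθ}(run of L^k bonds)` differs from `v_b` by at most
`τ = L^kT`, so the two bond forms differ by `≤ 2τ²d‖ψ‖²` (file 7 of this seat's member of SKELETON row **C1.Eq7.3.1-7.3.2**, GAPS G-C1-05).

statement-level skeleton of published theorems with citation tags; proofs where landed; nothing here is a claim about the Yang–Mills mass gap

PDF held: `paper:balaban1985-cmp97-bij-higgs-minimizers` (journal page = PDF page + 298).  Pages read (`lit read`, OCR text): p. 313 [PDF 15]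
((4.5.4), (5.1.2)), p. 326 [PDF 28] ((7.3.2)).

CITATION HEADER (lean-in-tree rule).  Phase-2 file of the lit-balaban TYPED SKELETON (HOME `run/shared/lean/pub/lit-balaban/`), seat p33 gen 6
(unit `lit-balaban-p33-g6`; TAKING line HOME/STATUS.md 2026-08-21T10:38:53Z; owner r15, referee ref-5).  Objects BY NAME: p11's `lineIter`
(`u_k(b)` = `u^{(k)}(b)`, (5.1.2)), `bondForm`, `sum_bond_eq`/`sum_sum_shift_dir`/`sum_norm_sq_eq`; this seat's `lineIter_qsstarGIter` (file 1),
`lineIter_mul`/`norm_lineIter_sub_one_le` (file 2), `bg454`/`phase` (file 4), `ineq732_background_phys` (file 5).  Theorems only.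

THE PRINTED TEXT, verbatim (p. 326 [PDF 28]): *"⟨φ, Δ_k(u_k)φ⟩ ≥ γ Σ_{b∈T₁^{(k)}} |u_k(b)φ(b₊) − φ(b₋)|² − Me_k^{2−α} Σ_{x∈T₁^{(k)}} |φ(x)|². (7.3.2)
The second form of the inequality substitutes v_b for u_k(b) in the covariant derivative of φ."*

WHAT IS PROVED (0 `sorry`, standard axioms).
* `lineIter_bg454` — `u_k = v·(e^{iθ})^{(k)}` bondwise for `u = Q^{s*}_kv·e^{iθ}`; `norm_toC_lineIter_bg454_sub_le` — `|u_k(b) − v_b| ≤ L^kT` if `|θ| ≤ T`.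
* `bondForm_le_of_close` — two unit-lattice bond fields `W`, `W′` with `|W(b) − W′(b)| ≤ δ`: `E_W(ψ) ≤ 2E_{W′}(ψ) + 2δ²d‖ψ‖²`.
* **`ineq732_background_phys_first`** — (7.3.2), FIRST form, at `u = Q^{s*}_kv·e^{iθ}` for EVERY `v` and every phase with `|θ_b| ≤ T`,
  `36d(2d+1)²τ² ≤ 1` (`τ = L^kT`), printed `a_k`, physical normalization:
  `(γ/2)·Σ_b |u_k(b)ψ(b₊) − ψ(b₋)|² − γ(d + 32d(2d+1)²)τ²·Σ_x |ψ(x)|² ≤ ⟨ψ, Δ_k(u)ψ⟩`, `γ = min(a/(10d), ⅕)`.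
HONEST SCOPE.  As files 5–6 (the rate (7.3.1) ⇒ `τ ≤ Ke_k𝓅(e_k)` is row C1.Eq7.2.2); nothing printed is contradicted or weakened.
-/

open scoped RealInnerProductSpace BigOperators
open Finset

namespace Literature.MathematicalPhysics.QuantumFieldTheory.BalabanImbrieJaffe1984to88.BIJ85Ineq732BackgroundFirst

open Literature.MathematicalPhysics.QuantumFieldTheory.Balaban1983to89
open BIJ88Sect3Statements (U1 toC norm_toC toC_one toC_mul)
open BIJ85Sect1Model (HiggsField)
open BIJ85BlockAveragesTorus BIJ85BlockAveragesTorusK BIJ85ScalarPropagatorTorus BIJ85ScalarPropagatorTorusK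
open BIJ85ScalarForm464
open BIJ85BlockAveragingIneq BIJ85Ineq732Flat BIJ85Ineq732PullBack BIJ85HolonomyDeviation BIJ85Ineq732Background BIJ85Ineq732BackgroundStab
open BIJ85Eq453GaugeField (qsstarGIter)

noncomputable section

variable {P : Params} {j : ℕ}

/-! ## §1 `u_k(b)` at the background (4.5.4) is `v_b` up to `L^kT` -/

/-- **(5.1.2) at the background (4.5.4)**: `u_k = u^{(k)}` (straight runs of `L^k` `η`-bonds) of `u = Q^{s*}_kv·e^{iθ}` is `v·(e^{iθ})^{(k)}` bondwise
(file 2's `lineIter_mul`, file 1's `lineIter_qsstarGIter = v`). [cite: BalabanImbrieJaffe1985, (5.1.2) p.313] -/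
theorem lineIter_bg454 {k : ℕ} (hk : j + k ≤ P.m + P.K) (v : GaugeField P (j + k) U1) (θ : PBond P j → ℝ) :
    lineIter (bg454 k v θ) k = fun c => v c * lineIter (phase θ) k c := by
  rw [bg454_def, lineIter_mul, lineIter_qsstarGIter k hk]

/-- **`|u_k(b) − v_b| ≤ L^kT`** at the background (4.5.4) if `|θ| ≤ T` on every `η`-bond (`|(e^{iθ})^{(k)}(b) − 1| ≤ L^kT`, file 2).
[cite: BalabanImbrieJaffe1985, (7.3.2) p.326] -/
theorem norm_toC_lineIter_bg454_sub_le {k : ℕ} (hk : j + k ≤ P.m + P.K) (v : GaugeField P (j + k) U1) {θ : PBond P j → ℝ} {T : ℝ}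
    (hθ : ∀ b, |θ b| ≤ T) (c : PBond P (j + k)) :
    ‖toC (lineIter (bg454 k v θ) k c) - toC (v c)‖ ≤ (P.L : ℝ) ^ k * T := by
  rw [lineIter_bg454 hk, toC_mul]
  have e : toC (v c) * toC (lineIter (phase θ) k c) - toC (v c) = toC (v c) * (toC (lineIter (phase θ) k c) - 1) := by ring
  rw [e, norm_mul, norm_toC, one_mul]
  exact norm_lineIter_sub_one_le (norm_toC_phase_sub_one_le hθ) k c

/-! ## §2 Two close unit-lattice bond fields have comparable bond forms -/

/-- `|a + b|² ≤ 2|a|² + 2|b|²`. [folklore] -/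
private theorem norm_add_sq_le_two (a b : ℂ) : ‖a + b‖ ^ 2 ≤ 2 * ‖a‖ ^ 2 + 2 * ‖b‖ ^ 2 := by
  have h1 : ‖a + b‖ ^ 2 ≤ (‖a‖ + ‖b‖) ^ 2 := pow_le_pow_left₀ (norm_nonneg _) (norm_add_le a b) 2
  nlinarith [sq_nonneg (‖a‖ - ‖b‖)]

/-- kernel: if two unit-lattice bond fields satisfy `|W(b) − W′(b)| ≤ δ` for every `b` then `E_W(ψ) ≤ 2E_{W′}(ψ) + 2δ²·d·‖ψ‖²`
(`|W(b)ψ(b₊) − ψ(b₋)|² ≤ 2|W′(b)ψ(b₊) − ψ(b₋)|² + 2δ²|ψ(b₊)|²`; every site is the final point of `d` bonds) — the passage between the two printed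
forms of (7.3.2). [cite: BalabanImbrieJaffe1985, (7.3.2) p.326] -/
theorem bondForm_le_of_close {i : ℕ} (W W' : GaugeField P i U1) {δ : ℝ} (hW : ∀ c, ‖toC (W c) - toC (W' c)‖ ≤ δ)
    (ψ : PiLp 2 (fun _ : Balaban1983to89.Site P i => ℂ)) :
    bondForm W ψ ≤ 2 * bondForm W' ψ + 2 * δ ^ 2 * (P.d * ‖ψ‖ ^ 2) := by
  have hδ : 0 ≤ δ := le_trans (norm_nonneg _) (hW ⟨default, ⟨0, P.hd⟩⟩)
  unfold bondForm
  calc ∑ c : PBond P i, ‖toC (W c) * ψ c.tgt - ψ c.src‖ ^ 2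
      ≤ ∑ c : PBond P i, (2 * ‖toC (W' c) * ψ c.tgt - ψ c.src‖ ^ 2 + 2 * (δ ^ 2 * ‖ψ c.tgt‖ ^ 2)) := by
        refine sum_le_sum fun c _ => ?_
        have e : toC (W c) * ψ c.tgt - ψ c.src = (toC (W' c) * ψ c.tgt - ψ c.src) + (toC (W c) - toC (W' c)) * ψ c.tgt := by ring
        rw [e]
        refine (norm_add_sq_le_two _ _).trans (add_le_add le_rfl (mul_le_mul_of_nonneg_left ?_ (by norm_num)))
        rw [norm_mul, mul_pow]
        exact mul_le_mul_of_nonneg_right (pow_le_pow_left₀ (norm_nonneg _) (hW c) 2) (sq_nonneg _)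
    _ = 2 * ∑ c : PBond P i, ‖toC (W' c) * ψ c.tgt - ψ c.src‖ ^ 2 + 2 * δ ^ 2 * ∑ c : PBond P i, ‖ψ c.tgt‖ ^ 2 := by
        rw [sum_add_distrib, ← mul_sum, ← mul_sum, ← mul_sum, mul_assoc]
    _ = _ := by
        congr 1
        rw [sum_bond_eq, ← sum_norm_sq_eq ψ]
        congr 1
        exact sum_sum_shift_dir (fun x => ‖ψ x‖ ^ 2)

/-! ## §3 (7.3.2), first printed form, at the background (4.5.4) -/

/-- **(7.3.2), FIRST PRINTED FORM (`u_k(b)` in the covariant derivative of `ψ`), AT THE (4.5.4)-SHAPED BACKGROUND `u = Q^{s*}_kv·e^{iθ}`** for EVERY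
`v` and every phase with `|θ_b| ≤ T`, `36d(2d+1)²τ² ≤ 1` (`τ = L^kT`), `1 ≤ k`, `j + k ≤ m + K`, printed `a_k`, physical normalization, every `ψ`:
`(γ/2)·Σ_{b∈T₁^{(k)}} |u_k(b)ψ(b₊) − ψ(b₋)|² − γ·(d + 32d(2d+1)²)·τ²·Σ_{x∈T₁^{(k)}} |ψ(x)|² ≤ ⟨ψ, Δ_k(u)ψ⟩`, `γ = min(a/(10d), ⅕)`
(`ineq732_background_phys` + `bondForm_le_of_close` with `δ = τ`). [cite: BalabanImbrieJaffe1985, (7.3.2) p.326] -/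
theorem ineq732_background_phys_first {k : ℕ} (hk1 : 1 ≤ k) (hk : j + k ≤ P.m + P.K) {a : ℝ} (ha : 0 < a)
    (v : GaugeField P (j + k) U1) {θ : PBond P j → ℝ} {T : ℝ} (hT : 0 ≤ T) (hθ : ∀ b, |θ b| ≤ T)
    (hτ : 36 * P.d * (2 * P.d + 1) ^ 2 * ((P.L : ℝ) ^ k * T) ^ 2 ≤ 1)
    {G : FineSp P j →ₗ[ℝ] FineSp P j}
    (hG : ∀ φ, opT (Dlin (cPhys P k) (bg454 k v θ)) (QlinK (bg454 k v θ) k) (BIJ85Sect4Statements.aK a P.L k) (G φ) = φ)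
    (ψ : CoarseSpK P j k) :
    min (a / (10 * P.d)) (1 / 5) / 2 * bondForm (lineIter (bg454 k v θ) k) ψ
        - min (a / (10 * P.d)) (1 / 5) * ((P.d + 32 * (P.d * (2 * P.d + 1) ^ 2)) * ((P.L : ℝ) ^ k * T) ^ 2)
          * ∑ x : Balaban1983to89.Site P (j + k), ‖ψ x‖ ^ 2
      ≤ ⟪ψ, deltaOp (QlinK (bg454 k v θ) k) (BIJ85Sect4Statements.aK a P.L k) G ψ⟫ := by
  have h := ineq732_background_phys hk1 hk ha v hT hθ hτ hG ψ
  have hclose := bondForm_le_of_close (lineIter (bg454 k v θ) k) v (norm_toC_lineIter_bg454_sub_le hk v hθ) ψ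
  rw [← sum_norm_sq_eq ψ] at hclose
  have hγ0 : 0 ≤ min (a / (10 * (P.d : ℝ))) (1 / 5) := le_min (by have := P.hd; positivity) (by norm_num)
  have hmono := mul_le_mul_of_nonneg_left hclose hγ0
  nlinarith [hmono, h]

end

end Literature.MathematicalPhysics.QuantumFieldTheory.BalabanImbrieJaffe1984to88.BIJ85Ineq732BackgroundFirst
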